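import Summits.QuantumFields.YangMills.Theorems.FlatTubeReductionNearFlatSplitGlue
import Summits.QuantumFields.YangMills.Theorems.FlatTubeReductionTubeMaximiser
import Summits.QuantumFields.YangMills.Theorems.FlatTubeReductionAssembly
import Summits.QuantumFields.YangMills.Theorems.FlatTubeReductionNearFlatRatioLaw
import HarnessLib

/-!
# Route `FlatTubeReduction` after its support layer: everything hinges on K1a `PinnedTubeRatioLaw` and K1b `ValleyRelocalisation`
# (parent crux `NearFlatRatioLaw`, stmt-QuantumFields-24720; rung R2b1 = RECORD-label femto gap)

Seat `ym-line-sfw-p1` g9 (prover; planner-of-record ym-idea-1).  With K2 `OffTubeSuppression` (`offTubeSuppression_proof`), the glue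
`NearFlatSplitGlue` (`nearFlatSplitGlue_proof`), the support `TubeMaximiser` (`tubeMaximiser_proof`) and the `Assembly` (`assembly_proof`) all
PROVED, the route and FemtoCutoffLadder's fixed-lattice node reduce BY NAME to the two Born–Oppenheimer cruxes of the valley split:

* ★ `nearFlatRatioLaw_of_pinned_valley : PinnedTubeRatioLaw → ValleyRelocalisation → NearFlatRatioLaw` (parent 24720 ⇐ K1a ∧ K1b);
* ★ `femtoGapFixedLattice_of_pinned_valley : PinnedTubeRatioLaw → ValleyRelocalisation → FemtoGapFixedLattice` and
  `fixedLatticeLaw_of_pinned_valley : … → Theses.FemtoCutoffLadder.FixedLatticeLaw` (FCL node stmt-QuantumFields-23943 ⇐ K1a ∧ K1b);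
* ★ `femtoGapOfRecord_of_pinned_valley_steps : PinnedTubeRatioLaw → ValleyRelocalisation → OctaveStepDecay → SubOctaveBounded → FemtoGapOfRecord`
  — the rung leaf from exactly the four open statements {K1a 24921, K1b 25191, OctaveStepDecay 24153, SubOctaveBounded 24085}.

HONEST FRAMING: bookkeeping over proved files; K1a (XL), K1b (XL) and the two ladder legs are OPEN and untouched.  R2b1 is a RECORD rung: nothing
here concerns infinite volume, the continuum, or the Clay Yang–Mills mass gap.  No definitions, no named facts, no `sorry`.

UPDATE 2026-08-30 (seat `ym-line-ftr-p1` g22, tree hygiene after route render f3821d4c): K1 `NearFlatRatioLaw` (stmt-QuantumFields-24720) is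
CLOSED·proved by `nearFlatRatioLaw_proof`; K1a/K1b went closed·MOOT and their route decls were dropped, so `PinnedTubeRatioLaw` /
`ValleyRelocalisation` now denote the verbatim plain definitions of `Theorems/FlatTubeReductionValleySplitDefs.lean` (namespace
`Theorems.FlatTubeReduction`).  §2 below records that K1a is a THEOREM a fortiori from K1 (`pinnedTubeRatioLaw_of_nearFlatRatioLaw`,
`pinnedTubeRatioLaw_holds`: drop the pinning hypothesis, any `κ ∈ (0,1/3)`), so the `_of_pinned_valley` family above is conditional on K1b alone;
`SubOctaveBounded` (24085) is aside (the route closes through `Assembly2` / `UpStepEv`).  Still no summit statement; not uniform in `L`, not a gap.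
-/

set_option autoImplicit false

namespace Summit.QuantumFields.YangMills.Theorems.FlatTubeReduction

open Summit.QuantumFields.YangMills.Theses.FlatTubeReduction

/-- ★ **Parent crux `NearFlatRatioLaw` (stmt-QuantumFields-24720) ⇐ K1a ∧ K1b**, the support `TubeMaximiser` being discharged by
`tubeMaximiser_proof` inside the proved glue `nearFlatSplitGlue_proof`. [cite: Luscher1983, §3] -/
theorem nearFlatRatioLaw_of_pinned_valley (h₁ : PinnedTubeRatioLaw) (h₂ : ValleyRelocalisation) : NearFlatRatioLaw :=
  nearFlatSplitGlue_proof h₁ h₂ tubeMaximiser_proof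

/-- ★ **The fixed-lattice leaf from K1a ∧ K1b** (K2 and the supports discharged). [cite: Luscher1983, §3] -/
theorem femtoGapFixedLattice_of_pinned_valley (h₁ : PinnedTubeRatioLaw) (h₂ : ValleyRelocalisation) :
    Summit.QuantumFields.YangMills.Theorems.FemtoTransferGap.FemtoGapFixedLattice :=
  femtoGapFixedLattice_of_nearFlatRatioLaw (nearFlatRatioLaw_of_pinned_valley h₁ h₂)

/-- ★ **FemtoCutoffLadder's node `FixedLatticeLaw` (stmt-QuantumFields-23943) from K1a ∧ K1b**, by name. [cite: Luscher1983, §3] -/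
theorem fixedLatticeLaw_of_pinned_valley (h₁ : PinnedTubeRatioLaw) (h₂ : ValleyRelocalisation) :
    Summit.QuantumFields.YangMills.Theses.FemtoCutoffLadder.FixedLatticeLaw :=
  fixedLatticeLaw_of_nearFlatRatioLaw (nearFlatRatioLaw_of_pinned_valley h₁ h₂)

/-- ★ **The rung leaf from exactly the route's four open statements**:
`PinnedTubeRatioLaw → ValleyRelocalisation → OctaveStepDecay → SubOctaveBounded → FemtoGapOfRecord`. [cite: LuscherWeiszWolff1991]
[cite: Luscher1983, §3] -/
theorem femtoGapOfRecord_of_pinned_valley_steps (h₁ : PinnedTubeRatioLaw) (h₂ : ValleyRelocalisation) (h₃ : OctaveStepDecay)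
    (h₄ : SubOctaveBounded) : Summit.QuantumFields.YangMills.Theorems.FemtoTransferGap.FemtoGapOfRecord :=
  femtoGapOfRecord_of_nearFlatRatioLaw_steps (nearFlatRatioLaw_of_pinned_valley h₁ h₂) h₃ h₄

/-! ## §2. K1a is a theorem (a fortiori from the closed crux K1) -/

/-- ★ **K1 ⇒ K1a**: the pinned-tube ratio law `PinnedTubeRatioLaw` (retired item stmt-QuantumFields-24921) follows from `NearFlatRatioLaw` by
dropping the Polyakov-pinning hypothesis (any `κ ∈ (0,1/3)`, here `κ = 1/6`). [cite: Luscher1983, §3] -/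
theorem pinnedTubeRatioLaw_of_nearFlatRatioLaw (h : NearFlatRatioLaw) : PinnedTubeRatioLaw := by
  intro L _
  obtain ⟨θ, C, β0, hθ0, hθ1, H⟩ := h L
  exact ⟨θ, 1 / 6, C, β0, hθ0, hθ1, by norm_num, by norm_num,
    fun β hβ Ω ψ hΩ hΩpos heig hψ horth hsupp _ => H β hβ Ω ψ hΩ hΩpos heig hψ horth hsupp⟩

/-- ★★ **K1a `PinnedTubeRatioLaw` holds** (every `L`, eventually in `β`), by `nearFlatRatioLaw_proof` (crux K1, stmt-QuantumFields-24720,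
closed·proved 2026-08-30). Fixed-lattice statement; not uniform in `L`, not a gap. [cite: Luscher1983, §3] -/
theorem pinnedTubeRatioLaw_holds : PinnedTubeRatioLaw :=
  pinnedTubeRatioLaw_of_nearFlatRatioLaw nearFlatRatioLaw_proof

end Summit.QuantumFields.YangMills.Theorems.FlatTubeReduction
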